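import Literature.Analysis.OperatorTheory.PseudoResolventOperator
import Literature.Analysis.OperatorTheory.AnalyticFredholm
import HarnessLib

/-!
# Relatively compact perturbations of a closed operator given by its resolvent: isolated
  eigenvalues (Albritton–Brué–Colombo 2022, §2.1, through pseudo-resolvents)

Analysis/OperatorTheory proofs-layer file (theorems only, no definitions, no named facts),
continuing `PseudoResolventOperator.lean` and `CompactPerturbationSpectrum.lean`. [ABC] §2.1:
"An operator `𝒯 : D(𝓛) → H` is relatively compact with respect to `𝓛` if `𝒯` is compact when
`D(𝓛)` is considered with the graph norm [equivalently: `𝒯 R(λ, 𝓛)` is compact]. … relatively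
compact perturbations do not disturb the essential spectrum … we typically know that the
perturbed operator `𝓛 + 𝒯` is invertible for `Re λ ≫ 1`. Hence, the spectrum in `{Re λ > μ}`
consists of isolated points" — and these points are eigenvalues of finite multiplicity.

Here the closed operator is `T = operatorOfResolvent J z₀` for an injective pseudo-resolvent
`J` on an open connected `D` (`J(z) = (z − T)⁻¹`, Kato VIII-§1.1), and `K` is a bounded operator
with `K J(z)` compact for `z ∈ D` (relative compactness). Since on `D(T)`

  `z − (T + K) = (1 − K J(z)) (z − T)`,

the bounded analytic compact-valued family `f(z) = K J(z)` governs `T + K` on `D`: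

* `inverse_of_isUnit`: if `1 − K J(z)` is invertible then `R = J(z)(1 − K J(z))⁻¹` is a
  two-sided inverse of `z − (T + K)` (`R` maps into `D(T)`, `(z − T − K)R = 1`,
  `R(z − T − K) = 1` on `D(T)`);
* `eigenvector_of_apply_eq`: a fixed vector `K J(z) ψ = ψ ≠ 0` gives the eigenvector
  `u = J(z)ψ ∈ D(T)`, `u ≠ 0`, `T u + K u = z u`; conversely
  `not_isUnit_of_eigenvector`: an eigenvector of `T + K` in `D(T)` with eigenvalue `z` makes
  `1 − K J(z)` non-invertible;
* `dichotomy` / `isolated_eigenvalues`: by the analytic Fredholm theorem (the tree's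
  `analytic_fredholm_holds`, Reed–Simon I Thm. VI.14) applied to `f`: either `1 − K J(z)` is
  invertible for NO `z ∈ D`, or the exceptional `z` form a discrete subset of `D` and each of
  them is an eigenvalue of `T + K` with an eigenvector in `D(T)`; the first alternative is
  excluded by a single good point.

## References

* D. Albritton, E. Brué, M. Colombo, *Non-uniqueness of Leray solutions of the forced
  Navier–Stokes equations*, Ann. of Math. 196 (2022), arXiv:2112.03116, §2.1 (relatively
  compact perturbations; "the spectrum in `{Re λ > μ}` consists of isolated points").
  [AlbrittonBrueColombo2022AnnMath]
* M. Reed, B. Simon, *Methods of Modern Mathematical Physics I*, Thm. VI.14 — the tree's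
  `analytic_fredholm_holds`. [ReedSimonI1980]
* T. Kato, *Perturbation Theory for Linear Operators* (1966), VIII-§1.1 (pseudo-resolvents),
  IV-§5.6 Thm. 5.35 (essential spectrum under relatively compact perturbation). [Kato1966]
-/

noncomputable section

open Set Filter Topology

namespace Literature.Analysis.OperatorTheory

namespace IsPseudoResolvent

section Interpretation

variable {E : Type*} [NormedAddCommGroup E] [NormedSpace ℂ E]
variable {D : Set ℂ} {J : ℂ → E →L[ℂ] E} {z₀ : ℂ} {hinj : Function.Injective (J z₀)}

/-- **A fixed vector of `K J(z)` is an eigenvector of `T + K`**: if `K J(z) ψ = ψ` then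
`u = J(z) ψ` lies in `D(T)` and `T u + K u = z u`; and `u ≠ 0` if `ψ ≠ 0`. [cite: AlbrittonBrueColombo2022AnnMath, §2.1] -/
theorem eigenvector_of_apply_eq (h : IsPseudoResolvent D J) (hz₀ : z₀ ∈ D) (K : E →L[ℂ] E)
    {z : ℂ} (hz : z ∈ D) {ψ : E} (hψ : (K * J z) ψ = ψ) :
    operatorOfResolvent J z₀ hinj ⟨J z ψ, h.apply_mem_domain_of_mem hz₀ hz ψ⟩ + K (J z ψ) =
      z • J z ψ := by
  rw [mul_apply_eq_comp] at hψ
  rw [h.apply_resolvent_of_mem hz₀ hz ψ, hψ]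
  abel

/-- … and the eigenvector is non-zero when `ψ` is (`J z (0) = 0 ≠ ψ = K J z ψ`). [folklore] -/
theorem apply_ne_zero_of_apply_eq (K : E →L[ℂ] E) {z : ℂ} {ψ : E} (hψ : (K * J z) ψ = ψ)
    (hψ0 : ψ ≠ 0) : J z ψ ≠ 0 := by
  intro h0
  rw [mul_apply_eq_comp, h0, map_zero] at hψ
  exact hψ0 hψ.symm

/-- **An eigenvector of `T + K` in `D(T)` with eigenvalue `z ∈ D` makes `1 − K J(z)`
non-invertible** (`w = z u − T u = K u ≠ 0` is in its kernel). [cite: AlbrittonBrueColombo2022AnnMath, §2.1] -/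
theorem not_isUnit_of_eigenvector [CompleteSpace E] (h : IsPseudoResolvent D J) (hz₀ : z₀ ∈ D)
    (K : E →L[ℂ] E) {z : ℂ} (hz : z ∈ D) {u : E} (hu : u ∈ (operatorOfResolvent J z₀ hinj).domain)
    (hu0 : u ≠ 0) (heig : operatorOfResolvent J z₀ hinj ⟨u, hu⟩ + K u = z • u) :
    ¬ IsUnit (1 - K * J z) := by
  intro hunit
  set w : E := z • u - operatorOfResolvent J z₀ hinj ⟨u, hu⟩ with hw
  have hJw : J z w = u := h.resolvent_apply_sub hz₀ hz hu
  have hwK : w = K u := by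
    rw [hw, ← heig]; abel
  -- `(1 − K J z) w = 0`
  have hker : (1 - K * J z) w = 0 := by
    rw [sub_apply, one_apply_eq_self, mul_apply_eq_comp, hJw, ← hwK, sub_self]
  have hinjU : Function.Injective ((1 - K * J z : E →L[ℂ] E) : E → E) :=
    (ContinuousLinearMap.isUnit_iff_bijective.1 hunit).1
  have hw0 : w = 0 := hinjU (by rw [hker, map_zero])
  apply hu0
  rw [← hJw, hw0, map_zero]

/-- **The inverse of `z − (T + K)` when `1 − K J(z)` is invertible**: with `V = (1 − K J(z))⁻¹`
and `R = J(z) V`, every `R v` lies in `D(T)` and `z R v − (T (R v) + K (R v)) = v`.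
[cite: AlbrittonBrueColombo2022AnnMath, §2.1] -/
theorem sub_apply_inverse_of_isUnit (h : IsPseudoResolvent D J) (hz₀ : z₀ ∈ D) (K : E →L[ℂ] E)
    {z : ℂ} (hz : z ∈ D) (hunit : IsUnit (1 - K * J z)) (v : E) :
    z • J z (Ring.inverse (1 - K * J z) v) -
        (operatorOfResolvent J z₀ hinj ⟨J z (Ring.inverse (1 - K * J z) v),
            h.apply_mem_domain_of_mem hz₀ hz _⟩ + K (J z (Ring.inverse (1 - K * J z) v))) = v := by
  set w : E := Ring.inverse (1 - K * J z) v with hw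
  rw [h.apply_resolvent_of_mem hz₀ hz w]
  -- `z J w − (z J w − w + K J w) = w − K J w = (1 − K J z) w = v`
  have hVw : (1 - K * J z) w = v := by
    have h1 : (1 - K * J z) * Ring.inverse (1 - K * J z) = 1 := Ring.mul_inverse_cancel _ hunit
    have h2 := congrArg (fun S : E →L[ℂ] E => S v) h1
    simpa only [mul_apply_eq_comp, one_apply_eq_self] using h2
  rw [sub_apply, one_apply_eq_self, mul_apply_eq_comp] at hVw
  rw [← hVw]
  abel

/-- … and `R (z u − (T u + K u)) = u` for `u ∈ D(T)`. [cite: AlbrittonBrueColombo2022AnnMath, §2.1] -/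
theorem inverse_apply_sub_of_isUnit (h : IsPseudoResolvent D J) (hz₀ : z₀ ∈ D) (K : E →L[ℂ] E)
    {z : ℂ} (hz : z ∈ D) (hunit : IsUnit (1 - K * J z)) {u : E}
    (hu : u ∈ (operatorOfResolvent J z₀ hinj).domain) :
    J z (Ring.inverse (1 - K * J z)
      (z • u - (operatorOfResolvent J z₀ hinj ⟨u, hu⟩ + K u))) = u := by
  set w : E := z • u - operatorOfResolvent J z₀ hinj ⟨u, hu⟩ with hw
  have hJw : J z w = u := h.resolvent_apply_sub hz₀ hz hu
  -- `z u − (T u + K u) = w − K J z w = (1 − K J z) w`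
  have heq : z • u - (operatorOfResolvent J z₀ hinj ⟨u, hu⟩ + K u) = (1 - K * J z) w := by
    rw [sub_apply, one_apply_eq_self, mul_apply_eq_comp, hJw, hw]
    abel
  rw [heq]
  have h1 : Ring.inverse (1 - K * J z) * (1 - K * J z) = 1 := Ring.inverse_mul_cancel _ hunit
  have h2 := congrArg (fun S : E →L[ℂ] E => S w) h1
  simp only [mul_apply_eq_comp, one_apply_eq_self] at h2
  rw [h2, hJw]

end Interpretation

/-! ### The analytic Fredholm dichotomy for `T + K` -/

section Dichotomy

variable {H : Type} [NormedAddCommGroup H] [InnerProductSpace ℂ H] [CompleteSpace H]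
variable {D : Set ℂ} {J : ℂ → H →L[ℂ] H}

/-- **Relatively compact perturbations: the dichotomy** ([ABC] §2.1 (i)/(ii) for `𝓛 + 𝒯` with
`𝒯` relatively compact; proof: analytic Fredholm theorem, Reed–Simon I Thm. VI.14, for
`f(z) = K J(z)` on `D`). Let `J` be a pseudo-resolvent on the open connected set `D` and `K` a
bounded operator with `K J(z)` compact for all `z ∈ D`. Then either `1 − K J(z)` is invertible
for no `z ∈ D`, or every `z ∈ D` has a punctured neighbourhood on which it is invertible and at
each exceptional point there is `ψ ≠ 0` with `K J(z) ψ = ψ` (whence an eigenvector `J(z)ψ` of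
`T + K`, `eigenvector_of_apply_eq`). [cite: AlbrittonBrueColombo2022AnnMath, §2.1 (spectral preliminaries (i)/(ii))] -/
theorem compact_perturbation_dichotomy (h : IsPseudoResolvent D J) (hD : IsOpen D)
    (hDc : IsConnected D) (K : H →L[ℂ] H) (hK : ∀ z ∈ D, IsCompactOperator (K * J z)) :
    (∀ z ∈ D, ¬ IsUnit (1 - K * J z)) ∨
      ((∀ z ∈ D, ∀ᶠ w in 𝓝[≠] z, IsUnit (1 - K * J w)) ∧
        ∀ z ∈ D, ¬ IsUnit (1 - K * J z) → ∃ ψ : H, ψ ≠ 0 ∧ (K * J z) ψ = ψ) :=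
  analytic_fredholm_holds H D (fun z => K * J z) hD hDc
    ((differentiableOn_const K).mul (h.differentiableOn hD)) hK

/-- **Isolated eigenvalues of `T + K` off the "free" spectrum** ([ABC] §2.1: "we typically know
that the perturbed operator `𝓛 + 𝒯` is invertible for `Re λ ≫ 1`. Hence, the spectrum in
`{Re λ > μ}` consists of isolated points", which are eigenvalues). With `J` an injective
pseudo-resolvent on the open connected `D` (the resolvent of the closed operator
`T = operatorOfResolvent J z₀`), `K J(z)` compact on `D`, and ONE point `z₁ ∈ D` where
`1 − K J(z₁)` is invertible: every `z ∈ D` has a punctured neighbourhood of invertibility (there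
`z − (T + K)` has the bounded inverse `J(z)(1 − K J(z))⁻¹`, `sub_apply_inverse_of_isUnit` /
`inverse_apply_sub_of_isUnit`), and at every exceptional `z ∈ D` the operator `T + K` has an
eigenvector in `D(T)` with eigenvalue `z`. [cite: AlbrittonBrueColombo2022AnnMath, §2.1 (spectral preliminaries)] -/
theorem compact_perturbation_isolated_eigenvalues (h : IsPseudoResolvent D J) (hD : IsOpen D)
    (hDc : IsConnected D) {z₀ : ℂ} (hz₀ : z₀ ∈ D) {hinj : Function.Injective (J z₀)}
    (K : H →L[ℂ] H) (hK : ∀ z ∈ D, IsCompactOperator (K * J z)) {z₁ : ℂ} (hz₁ : z₁ ∈ D)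
    (hz₁u : IsUnit (1 - K * J z₁)) :
    (∀ z ∈ D, ∀ᶠ w in 𝓝[≠] z, IsUnit (1 - K * J w)) ∧
      ∀ z ∈ D, ¬ IsUnit (1 - K * J z) →
        ∃ u : H, u ≠ 0 ∧ ∃ hu : u ∈ (operatorOfResolvent J z₀ hinj).domain,
          operatorOfResolvent J z₀ hinj ⟨u, hu⟩ + K u = z • u := by
  rcases h.compact_perturbation_dichotomy hD hDc K hK with hbad | ⟨h1, h2⟩
  · exact absurd hz₁u (hbad z₁ hz₁)
  · refine ⟨h1, fun z hz hnu => ?_⟩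
    obtain ⟨ψ, hψ0, hψ⟩ := h2 z hz hnu
    exact ⟨J z ψ, apply_ne_zero_of_apply_eq K hψ hψ0, h.apply_mem_domain_of_mem hz₀ hz ψ,
      h.eigenvector_of_apply_eq hz₀ K hz hψ⟩

end Dichotomy

end IsPseudoResolvent

end Literature.Analysis.OperatorTheory
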